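/-
Copyright (c) 2026 the pub-hodgecm-mathlib formalisation cell (harness21).  Prover seat hodgecm-mathlib-F0P3a-p08 (g19): «S3-ram» seeding wave (LEAD F0P3a-plan (g12), owner
F0P3a-p06 (g15)), row (e2)(b) «[T2-c]-ram» (layer 3 ★ p846982∕p847012∕p847016∕p847046∕p847083∕p847126), sub-organ (D5)-ram «LAYER 3 DISCHARGED AT THE PLACE»; 2026-09-01.
-/
import Literature.NumberTheory.Automorphic.TypeTwoOrderNormUnitIndexRamifiedBase     -- ★ p847126 (this seat): `relIndex_units_comap_norm_eq_typeA ∕ _typeB` (layer 3)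
import Literature.NumberTheory.Rogawski1990.TypeTwoUnitIndexAtPlace                 -- ★ p846715 (D5) (this lineage, g18): the INERT template; brings the place dictionary ★ `SplitTorusOrderFixedSidePlace`, `exists_integer_ringHom_of_map_mem_integer`
import Literature.NumberTheory.Automorphic.RamifiedPlaceIntegerInvolution            -- ★ `exists_integer_involution_of_ramified`; brings ★ `AdicCompletionLocalField` (complete ∕ DVR ∕ finite residue field instances)
import Literature.NumberTheory.Automorphic.Liu2021.LemD1AsPrintedIndexedNonVacuityRamifiedPlace   -- ★ `ramificationIdx'_eq_two_of_ne_one`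
import HarnessLib

/-!
# (D5)-ram «[T2-c]-ram LAYER 3 DISCHARGED AT THE PLACE»: the type-(2) unit index `[C : R^×]` at a TAMELY RAMIFIED place `w ∣ v`, over the UNRAMIFIED eigen-field `K = E_w(√ε₀)`
# (Rogawski 1990 §4.9; Serre, *Local Fields* Ch. I §6, Ch. V §2–§3)

Topic `NumberTheory/Rogawski1990`; namespace `Literature.NumberTheory.Rogawski1990`.  THEOREMS ONLY (no definition, no instance, no notation, no named fact, no `sorry`); kernel lane
`--supports stmt-HodgeConjecture-24833`.  Cell `pub/hodgecm-mathlib` (D-0151), crux H413; «S3-ram» seeding wave, row (e2)(b) «[T2-c]-ram» — the RAMIFIED-PLACE twin of ★ (D5)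
`exists_integers_relIndex_units_comap_norm_eq_place` (F0P3a-p08 (g18)): every dictionary binder of the generic layer-3 heads ★ `relIndex_units_comap_norm_eq_typeA ∕ _typeB`
(`ιO σO j σ₁ θ`, `hθ hns hcoord`, `u t y D e₂ lam h2 hD hlam hu1 ht2`, `hϖ hn hN`, `hσσ hσ₁σ₁ hσ₁j hx1 huD`, the ramified base `hcoordE hσι hσϖO h2F hϖOu hϖOsq hϖF hk₀F hϖOv hε₀`, the
instances) is DISCHARGED at `F_v ⊂ E_w` (`ι = toPlace v w`, `σ = galAdicCompletionMap c hw`, `c • w = w`, `e(w|v) ≠ 1`, `|2|_w = 1`) with `O₁ := 𝒪[K]`, `K := M_{w₁}` the completion of a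
quadratic extension `M ⊃ E` at `w₁ ∣ w`, GIVEN AS HYPOTHESES (exactly as ★ (D5) took ★ (D2-β)'s outputs): (R) the ramified Eisenstein package of `E_w ∕ F_v` — an anti-fixed `ϖE`,
`ϖE² = ι k₀`, `k₀` a uniformiser of `F_v`, unique coordinates `z = ι p + ι q·ϖE` with integrality iff `p, q ∈ 𝒪_v` (★ [T2-L] `exists_sqrt_and_coord_of_ramified` (L1) at
`(F, E) := (L⁺, L)` + ★ `RamifiedPlaceAntiFixedUniformizer`); (U) the UNRAMIFIED eigen-field package of `K ∕ E_w` — `θ² = ι₁ι ε₀` with `ε₀ ∈ 𝒪_v^×` of non-square residue (read in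
`E_w`: `|b² − ι ε₀|_w = 1` on `𝒪_w`), coordinates ∕ integrality over `E_w`, an involution `s̃` of `K` over `σ` with `s̃ 𝒪 ⊆ 𝒪` and the TYPE bit `s̃ θ = θ` (A) ∕ `s̃ θ = −θ` (B);
and the type-(2) eigen-data `u t D y e₂` with the TYPE-AGNOSTIC unitarity `u·σu = 1`, `λ·s̃λ = 1` (`λ := (ι₁t + ι₁y·θ)·ι₁e₂`), `|D|_w = 1`, depths `|u² − tu + D|_w = exp(−n)`,
`|y|_w = exp(−N)`, `1 ≤ N`, `2 ≤ N + n`.  OUTPUT: the integral ring maps and lifts with their coercion identities (★ (D5)'s block VERBATIM) and, for `R = 𝒪_w[(u, λ)] ≤ 𝒪_w × 𝒪[K]`,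
`C = {c : c·c⋆ ∈ R^×}`:  **`[C : R^×] = 2·N(v)^{(N+n−1)∕2}` if `s̃θ = θ` and `N + n` is odd;  `[C : R^×] = (N(v)+1)·N(v)^{(N+n−2)∕2}` if `s̃θ = −θ` and `N + n` is even**
(A-p19 (g26) CERT «[T2-c]-ram»; the parity is the torus-type law, consumer-supplied — ref5 R-254).  Inert value (★ (D5)): `(N(v)+1)·N(v)^{N+n−1}`.
HONEST LABEL: HC_CM is proved only modulo the 2 remaining named inputs (hLiu418 24832, h413 24833) until rung 0 closes; unconditional local algebra, count-neutral.

* **`exists_integers_relIndex_units_comap_norm_eq_ramifiedPlace`** — (D5)-ram, both types in one existential block (two implications).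

## References
* [Rogawski1990] J. D. Rogawski, *Automorphic Representations of Unitary Groups in Three Variables* (1990): §4.9 Lemma 4.9.3 p. 56, Prop. 4.9.1 (b) p. 55.
* [SerreLocalFields1979] J.-P. Serre, *Local Fields*, GTM 67 (1979): Ch. I §6 Prop. 17–18; Ch. V §2 Prop. 3; Ch. V §3 Prop. 5 and Cor. 2.
* [Neukirch1999] J. Neukirch, *Algebraic Number Theory*, Grundlehren 322 (1999): Ch. I §12; Ch. II §4 Prop. (4.3).
-/

set_option autoImplicit false

noncomputable section

open ValuativeRel NumberField IsDedekindDomain Polynomial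
open scoped ValuativeRel
open Literature.NumberTheory.Automorphic Literature.NumberTheory.Automorphic.UnitaryGroup

namespace Literature.NumberTheory.Rogawski1990

set_option maxHeartbeats 20000000 in
/-- **(D5)-ram «[T2-c]-ram LAYER 3 DISCHARGED AT THE PLACE»** — see the module docstring.  Frame: `E ∕ F` quadratic number fields, `c ≠ 1`, `w ∣ v` with `c • w = w`,
`e(w|v) ≠ 1`, `|2|_w = 1`; (R) the Eisenstein package `(ϖE, k₀)` of `E_w ∕ F_v`; `K = M_{w₁}` with the unramified package `(ε₀, θ, s̃)` and its type bit; eigen-data `u t D y e₂`.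
[cite: Rogawski1990, §4.9 Lemma 4.9.3 p. 56; Prop. 4.9.1 (b) p. 55] [cite: SerreLocalFields1979, Ch. V §3 Prop. 5 and Cor. 2; Ch. V §2 Prop. 3] [cite: Neukirch1999, Ch. I §12] -/
theorem exists_integers_relIndex_units_comap_norm_eq_ramifiedPlace
    {F E : Type} [Field F] [NumberField F] [Field E] [NumberField E] [Algebra F E] [Algebra.IsQuadraticExtension F E]
    (c : E ≃ₐ[F] E) (v : HeightOneSpectrum (𝓞 F)) (hc : c ≠ 1)
    (w : PlacesOver E v) (hw : c • w.1 = w.1) (he : v.asIdeal.ramificationIdx' w.1.asIdeal ≠ 1) (h2 : Valued.v (2 : w.1.adicCompletion E) = 1)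
    -- (R) the ramified Eisenstein package of `E_w ∕ F_v`
    {k₀ : v.adicCompletion F} (hk₀ : Valued.v k₀ = WithZero.exp (-1 : ℤ)) {ϖE : w.1.adicCompletion E} (hϖE : ϖE ^ 2 = toPlace v w k₀)
    (hσϖE : galAdicCompletionMap (L := E) c hw ϖE = -ϖE)
    (hcoordE : ∀ z : w.1.adicCompletion E, ∃! pq : v.adicCompletion F × v.adicCompletion F, z = toPlace v w pq.1 + toPlace v w pq.2 * ϖE)
    (hintE : ∀ p q : v.adicCompletion F, toPlace v w p + toPlace v w q * ϖE ∈ 𝒪[w.1.adicCompletion E] ↔ p ∈ 𝒪[v.adicCompletion F] ∧ q ∈ 𝒪[v.adicCompletion F])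
    -- (U) the unramified eigen-field `K = M_{w₁} = E_w(√ε₀)` and its package
    {M : Type} [Field M] [NumberField M] [Algebra E M] (w₁ : PlacesOver M w.1)
    {ε₀ : v.adicCompletion F} (hns : ∀ b : w.1.adicCompletion E, Valued.v b ≤ 1 → Valued.v (b * b - toPlace v w ε₀) = 1)
    {θ : w₁.1.adicCompletion M} (s' : w₁.1.adicCompletion M →+* w₁.1.adicCompletion M)
    (hθ : θ ^ 2 = toPlace w.1 w₁ (toPlace v w ε₀))
    (hcoord : ∀ z : w₁.1.adicCompletion M, ∃! pq : w.1.adicCompletion E × w.1.adicCompletion E, z = toPlace w.1 w₁ pq.1 + toPlace w.1 w₁ pq.2 * θ)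
    (hint : ∀ p q : w.1.adicCompletion E, toPlace w.1 w₁ p + toPlace w.1 w₁ q * θ ∈ 𝒪[w₁.1.adicCompletion M] ↔ p ∈ 𝒪[w.1.adicCompletion E] ∧ q ∈ 𝒪[w.1.adicCompletion E])
    (hs'ι : ∀ x, s' (toPlace w.1 w₁ x) = toPlace w.1 w₁ (galAdicCompletionMap (L := E) c hw x)) (hs's' : ∀ z, s' (s' z) = z)
    (hs'O : ∀ z : 𝒪[w₁.1.adicCompletion M], s' z ∈ 𝒪[w₁.1.adicCompletion M])
    -- the type-(2) eigen-data of a deep match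
    (u t D y e₂ : w.1.adicCompletion E) (hu1 : Valued.v (u - 1) < 1) (ht2 : Valued.v (t - 2) < 1) (h2e : e₂ * 2 = 1)
    (hD : 4 * D = t * t - y * y * toPlace v w ε₀) (hDv : Valued.v D = 1)
    (hσu : u * galAdicCompletionMap (L := E) c hw u = 1)
    (hlam1 : ((toPlace w.1 w₁ t + toPlace w.1 w₁ y * θ) * toPlace w.1 w₁ e₂) * s' ((toPlace w.1 w₁ t + toPlace w.1 w₁ y * θ) * toPlace w.1 w₁ e₂) = 1)
    {n N : ℕ} (hn : Valued.v (u * u - t * u + D) = WithZero.exp (-(n : ℤ))) (hN : Valued.v y = WithZero.exp (-(N : ℤ))) (hN1 : 1 ≤ N) (hNn : 2 ≤ N + n) :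
    ∃ (ιO : 𝒪[v.adicCompletion F] →+* 𝒪[w.1.adicCompletion E]) (σO : 𝒪[w.1.adicCompletion E] →+* 𝒪[w.1.adicCompletion E]) (jO : 𝒪[w.1.adicCompletion E] →+* 𝒪[w₁.1.adicCompletion M]) (σ₁O : 𝒪[w₁.1.adicCompletion M] →+* 𝒪[w₁.1.adicCompletion M])
      (uO tO yO DO e₂O : 𝒪[w.1.adicCompletion E]) (lamO : 𝒪[w₁.1.adicCompletion M]),
      (∀ x : 𝒪[v.adicCompletion F], ((ιO x : 𝒪[w.1.adicCompletion E]) : w.1.adicCompletion E) = toPlace v w x) ∧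
      (∀ x : 𝒪[w.1.adicCompletion E], ((σO x : 𝒪[w.1.adicCompletion E]) : w.1.adicCompletion E) = galAdicCompletionMap (L := E) c hw x) ∧
      (∀ x : 𝒪[w.1.adicCompletion E], ((jO x : 𝒪[w₁.1.adicCompletion M]) : w₁.1.adicCompletion M) = toPlace w.1 w₁ x) ∧
      (∀ z : 𝒪[w₁.1.adicCompletion M], ((σ₁O z : 𝒪[w₁.1.adicCompletion M]) : w₁.1.adicCompletion M) = s' z) ∧
      (uO : w.1.adicCompletion E) = u ∧ (tO : w.1.adicCompletion E) = t ∧ (yO : w.1.adicCompletion E) = y ∧ (DO : w.1.adicCompletion E) = D ∧ (e₂O : w.1.adicCompletion E) = e₂ ∧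
      (lamO : w₁.1.adicCompletion M) = (toPlace w.1 w₁ t + toPlace w.1 w₁ y * θ) * toPlace w.1 w₁ e₂ ∧
      (s' θ = θ → Odd (N + n) →
        (Units.map ((Polynomial.eval₂RingHom (RingHom.prod (RingHom.id 𝒪[w.1.adicCompletion E]) jO) ((uO, lamO) : 𝒪[w.1.adicCompletion E] × 𝒪[w₁.1.adicCompletion M])).range.subtype :
            (Polynomial.eval₂RingHom (RingHom.prod (RingHom.id 𝒪[w.1.adicCompletion E]) jO) ((uO, lamO) : 𝒪[w.1.adicCompletion E] × 𝒪[w₁.1.adicCompletion M])).range →* 𝒪[w.1.adicCompletion E] × 𝒪[w₁.1.adicCompletion M])).range.relIndex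
          ((Units.map ((Polynomial.eval₂RingHom (RingHom.prod (RingHom.id 𝒪[w.1.adicCompletion E]) jO) ((uO, lamO) : 𝒪[w.1.adicCompletion E] × 𝒪[w₁.1.adicCompletion M])).range.subtype :
            (Polynomial.eval₂RingHom (RingHom.prod (RingHom.id 𝒪[w.1.adicCompletion E]) jO) ((uO, lamO) : 𝒪[w.1.adicCompletion E] × 𝒪[w₁.1.adicCompletion M])).range →* 𝒪[w.1.adicCompletion E] × 𝒪[w₁.1.adicCompletion M])).range.comap
            (MonoidHom.id (𝒪[w.1.adicCompletion E] × 𝒪[w₁.1.adicCompletion M])ˣ * Units.map (RingHom.prodMap σO σ₁O : 𝒪[w.1.adicCompletion E] × 𝒪[w₁.1.adicCompletion M] →* 𝒪[w.1.adicCompletion E] × 𝒪[w₁.1.adicCompletion M]))) =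
          2 * Ideal.absNorm v.asIdeal ^ ((N + n - 1) / 2)) ∧
      (s' θ = -θ → Even (N + n) →
        (Units.map ((Polynomial.eval₂RingHom (RingHom.prod (RingHom.id 𝒪[w.1.adicCompletion E]) jO) ((uO, lamO) : 𝒪[w.1.adicCompletion E] × 𝒪[w₁.1.adicCompletion M])).range.subtype :
            (Polynomial.eval₂RingHom (RingHom.prod (RingHom.id 𝒪[w.1.adicCompletion E]) jO) ((uO, lamO) : 𝒪[w.1.adicCompletion E] × 𝒪[w₁.1.adicCompletion M])).range →* 𝒪[w.1.adicCompletion E] × 𝒪[w₁.1.adicCompletion M])).range.relIndex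
          ((Units.map ((Polynomial.eval₂RingHom (RingHom.prod (RingHom.id 𝒪[w.1.adicCompletion E]) jO) ((uO, lamO) : 𝒪[w.1.adicCompletion E] × 𝒪[w₁.1.adicCompletion M])).range.subtype :
            (Polynomial.eval₂RingHom (RingHom.prod (RingHom.id 𝒪[w.1.adicCompletion E]) jO) ((uO, lamO) : 𝒪[w.1.adicCompletion E] × 𝒪[w₁.1.adicCompletion M])).range →* 𝒪[w.1.adicCompletion E] × 𝒪[w₁.1.adicCompletion M])).range.comap
            (MonoidHom.id (𝒪[w.1.adicCompletion E] × 𝒪[w₁.1.adicCompletion M])ˣ * Units.map (RingHom.prodMap σO σ₁O : 𝒪[w.1.adicCompletion E] × 𝒪[w₁.1.adicCompletion M] →* 𝒪[w.1.adicCompletion E] × 𝒪[w₁.1.adicCompletion M]))) =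
          (Ideal.absNorm v.asIdeal + 1) * Ideal.absNorm v.asIdeal ^ ((N + n - 2) / 2)) := by
  -- ### 0. valuation bridges
  have hι₁inj : Function.Injective (toPlace w.1 w₁) := (toPlace w.1 w₁).injective
  have hιinjK : Function.Injective (toPlace v w) := (toPlace v w).injective
  have hσv : ∀ x : w.1.adicCompletion E, Valued.v (galAdicCompletionMap (L := E) c hw x) = Valued.v x :=
    fun x => valued_galAdicCompletionMap (L := E) c hw x
  have he2 : v.asIdeal.ramificationIdx' w.1.asIdeal = 2 :=
    Literature.NumberTheory.Automorphic.Liu2021.LemD1IndexedNonVacuityRamifiedPlace.ramificationIdx'_eq_two_of_ne_one E v c hc w hw he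
  have hιv : ∀ x : v.adicCompletion F, Valued.v (toPlace v w x) = Valued.v x ^ 2 := fun x => by rw [valued_toPlace v w x, he2]
  have hσσK : ∀ x : w.1.adicCompletion E, galAdicCompletionMap (L := E) c hw (galAdicCompletionMap (L := E) c hw x) = x :=
    galAdicCompletionMap_galAdicCompletionMap_of_smul_eq c w hc hw
  -- squares in `ℤᵐ⁰`
  have hsq : ∀ x : WithZero (Multiplicative ℤ), x * x = 1 → x = 1 := fun x h => by
    rcases eq_or_ne x 0 with h0 | h0
    · rw [h0, zero_mul] at h; exact absurd h zero_ne_one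
    · rw [← WithZero.exp_log h0, ← WithZero.exp_add, WithZero.exp_eq_one] at h
      rw [← WithZero.exp_log h0, show WithZero.log x = 0 by omega, WithZero.exp_zero]
  have hunitE : ∀ x : 𝒪[w.1.adicCompletion E], IsUnit x ↔ Valued.v (x : w.1.adicCompletion E) = 1 := fun x => by
    rw [(Valuation.integer.integers (valuation (w.1.adicCompletion E))).isUnit_iff_valuation_eq_one, v_eq_one_iff_valuation_eq_one]; rfl
  have hunitF : ∀ x : 𝒪[v.adicCompletion F], IsUnit x ↔ Valued.v (x : v.adicCompletion F) = 1 := fun x => by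
    rw [(Valuation.integer.integers (valuation (v.adicCompletion F))).isUnit_iff_valuation_eq_one, v_eq_one_iff_valuation_eq_one]; rfl
  have hmaxE : ∀ x : 𝒪[w.1.adicCompletion E], Valued.v (x : w.1.adicCompletion E) < 1 → x ∈ IsLocalRing.maximalIdeal 𝒪[w.1.adicCompletion E] :=
    fun x hx => by rw [IsLocalRing.mem_maximalIdeal, mem_nonunits_iff, hunitE]; exact hx.ne
  -- ### 1. integrality of the data
  have hle_of_sub : ∀ {x c₀ : w.1.adicCompletion E}, Valued.v (x - c₀) < 1 → Valued.v c₀ ≤ 1 → Valued.v x ≤ 1 := fun {x c₀} hx hc₀ => by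
    have := Valued.v.map_add_le hx.le hc₀; rwa [sub_add_cancel] at this
  have huO : u ∈ 𝒪[w.1.adicCompletion E] := (v_le_one_iff_mem_integer u).1 (hle_of_sub hu1 (by rw [map_one]))
  have htO : t ∈ 𝒪[w.1.adicCompletion E] := (v_le_one_iff_mem_integer t).1 (hle_of_sub ht2 h2.le)
  have hDO : D ∈ 𝒪[w.1.adicCompletion E] := (v_le_one_iff_mem_integer D).1 hDv.le
  have hyO : y ∈ 𝒪[w.1.adicCompletion E] := (v_le_one_iff_mem_integer y).1 (by
    rw [hN, ← WithZero.exp_zero]; exact WithZero.exp_le_exp.2 (by omega))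
  have he₂v : Valued.v e₂ = 1 := by
    have h := congrArg Valued.v h2e; rw [map_mul, h2, mul_one, map_one] at h; exact h
  have he₂O : e₂ ∈ 𝒪[w.1.adicCompletion E] := (v_le_one_iff_mem_integer e₂).1 he₂v.le
  have hk₀O : k₀ ∈ 𝒪[v.adicCompletion F] := (v_le_one_iff_mem_integer k₀).1 (by
    rw [hk₀, ← WithZero.exp_zero]; exact WithZero.exp_le_exp.2 (by norm_num))
  have hε₀v : Valued.v (toPlace v w ε₀) = 1 := by
    have h := hns 0 (by rw [map_zero]; exact zero_le_one)
    rwa [zero_mul, zero_sub, Valuation.map_neg] at h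
  have hε₀Fv : Valued.v ε₀ = 1 := hsq _ (by rw [← sq, ← hιv, hε₀v])
  have hε₀O : ε₀ ∈ 𝒪[v.adicCompletion F] := (v_le_one_iff_mem_integer ε₀).1 hε₀Fv.le
  have hϖEv : Valued.v ϖE = WithZero.exp (-1 : ℤ) := by
    have h : Valued.v ϖE ^ 2 = WithZero.exp (-1 : ℤ) ^ 2 := by rw [← map_pow, hϖE, hιv, hk₀]
    exact (pow_left_inj₀ zero_le zero_le two_ne_zero).1 h
  have hϖEO : ϖE ∈ 𝒪[w.1.adicCompletion E] := (v_le_one_iff_mem_integer ϖE).1 (by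
    rw [hϖEv, ← WithZero.exp_zero]; exact WithZero.exp_le_exp.2 (by norm_num))
  have hθO : θ ∈ 𝒪[w₁.1.adicCompletion M] := by
    have h := (hint 0 1).2 ⟨zero_mem _, one_mem _⟩
    rwa [map_zero, map_one, zero_add, one_mul] at h
  -- ### 2. the integral ring maps and lifts
  obtain ⟨ιO, hιO⟩ := exists_integer_ringHom_toPlace v w
  obtain ⟨jO, hjO⟩ := exists_integer_ringHom_toPlace w.1 w₁
  obtain ⟨σO, hσO, hσσ, hresE, hcardE⟩ := exists_integer_involution_of_ramified E c hc v w hw he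
  obtain ⟨σ₁O, hσ₁O⟩ := exists_integer_ringHom_of_map_mem_integer s' hs'O
  obtain ⟨uO, huO'⟩ : ∃ uO : 𝒪[w.1.adicCompletion E], (uO : w.1.adicCompletion E) = u := ⟨⟨u, huO⟩, rfl⟩
  obtain ⟨tO, htO'⟩ : ∃ tO : 𝒪[w.1.adicCompletion E], (tO : w.1.adicCompletion E) = t := ⟨⟨t, htO⟩, rfl⟩
  obtain ⟨yO, hyO'⟩ : ∃ yO : 𝒪[w.1.adicCompletion E], (yO : w.1.adicCompletion E) = y := ⟨⟨y, hyO⟩, rfl⟩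
  obtain ⟨DO, hDO'⟩ : ∃ DO : 𝒪[w.1.adicCompletion E], (DO : w.1.adicCompletion E) = D := ⟨⟨D, hDO⟩, rfl⟩
  obtain ⟨e₂O, he₂O'⟩ : ∃ e₂O : 𝒪[w.1.adicCompletion E], (e₂O : w.1.adicCompletion E) = e₂ := ⟨⟨e₂, he₂O⟩, rfl⟩
  obtain ⟨θO, hθO'⟩ : ∃ θO : 𝒪[w₁.1.adicCompletion M], (θO : w₁.1.adicCompletion M) = θ := ⟨⟨θ, hθO⟩, rfl⟩
  obtain ⟨ϖO, hϖO'⟩ : ∃ ϖO : 𝒪[w.1.adicCompletion E], (ϖO : w.1.adicCompletion E) = ϖE := ⟨⟨ϖE, hϖEO⟩, rfl⟩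
  obtain ⟨k₀F, hk₀F'⟩ : ∃ k₀F : 𝒪[v.adicCompletion F], (k₀F : v.adicCompletion F) = k₀ := ⟨⟨k₀, hk₀O⟩, rfl⟩
  obtain ⟨ε₀F, hε₀F'⟩ : ∃ ε₀F : 𝒪[v.adicCompletion F], (ε₀F : v.adicCompletion F) = ε₀ := ⟨⟨ε₀, hε₀O⟩, rfl⟩
  obtain ⟨lamO, hlamOdef⟩ : ∃ lamO : 𝒪[w₁.1.adicCompletion M], lamO = jO (e₂O * tO) + jO (e₂O * yO) * θO := ⟨_, rfl⟩
  have hlamO : (lamO : w₁.1.adicCompletion M) = (toPlace w.1 w₁ t + toPlace w.1 w₁ y * θ) * toPlace w.1 w₁ e₂ := by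
    rw [hlamOdef, Subring.coe_add, Subring.coe_mul, hjO, hjO, Subring.coe_mul, Subring.coe_mul, map_mul, map_mul, he₂O', htO', hyO', hθO']
    ring
  -- ### 3. the dictionary binders of the layer-3 heads
  have hσι : ∀ y', σO (ιO y') = ιO y' := fun y' => Subtype.ext (by rw [hσO, hιO, galAdicCompletionMap_toPlace c w w hw])
  have hσ₁j : ∀ x, σ₁O (jO x) = jO (σO x) := fun x => Subtype.ext (by rw [hσ₁O, hjO, hjO, hσO, hs'ι])
  have hσ₁σ₁ : ∀ z, σ₁O (σ₁O z) = z := fun z => Subtype.ext (by rw [hσ₁O, hσ₁O, hs's'])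
  have hθ' : θO ^ 2 = jO (ιO ε₀F) := Subtype.ext (by rw [Subring.coe_pow, hjO, hιO, hθO', hε₀F']; exact hθ)
  have hnsO : ∀ b : 𝒪[w.1.adicCompletion E], IsUnit (b * b - ιO ε₀F) := fun b => by
    rw [hunitE]; push_cast; rw [hιO, hε₀F']; exact hns _ ((v_le_one_iff_mem_integer _).2 b.2)
  have hcoordO : ∀ z : 𝒪[w₁.1.adicCompletion M], ∃! bc : 𝒪[w.1.adicCompletion E] × 𝒪[w.1.adicCompletion E], z = jO bc.1 + jO bc.2 * θO := by
    intro z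
    obtain ⟨⟨p, q⟩, hz, huniq⟩ := hcoord (z : w₁.1.adicCompletion M)
    have hpq : p ∈ 𝒪[w.1.adicCompletion E] ∧ q ∈ 𝒪[w.1.adicCompletion E] := (hint p q).1 (hz ▸ z.2)
    refine ⟨(⟨p, hpq.1⟩, ⟨q, hpq.2⟩), Subtype.ext ?_, fun bc hbc => ?_⟩
    · rw [Subring.coe_add, Subring.coe_mul, hjO, hjO, hθO']; exact hz
    · have hbc' : (z : w₁.1.adicCompletion M) = toPlace w.1 w₁ bc.1 + toPlace w.1 w₁ bc.2 * θ := by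
        have := congrArg (fun x : 𝒪[w₁.1.adicCompletion M] => (x : w₁.1.adicCompletion M)) hbc
        simp only [Subring.coe_add, Subring.coe_mul, hjO, hθO'] at this
        exact this
      have h := huniq (((bc.1 : w.1.adicCompletion E)), (bc.2 : w.1.adicCompletion E)) hbc'
      rw [Prod.mk.injEq] at h
      exact Prod.ext (Subtype.ext h.1) (Subtype.ext h.2)
  have hcoordEO : ∀ a : 𝒪[w.1.adicCompletion E], ∃! bc : 𝒪[v.adicCompletion F] × 𝒪[v.adicCompletion F], a = ιO bc.1 + ιO bc.2 * ϖO := by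
    intro a
    obtain ⟨⟨p, q⟩, ha, huniq⟩ := hcoordE (a : w.1.adicCompletion E)
    have hpq : p ∈ 𝒪[v.adicCompletion F] ∧ q ∈ 𝒪[v.adicCompletion F] := (hintE p q).1 (ha ▸ a.2)
    refine ⟨(⟨p, hpq.1⟩, ⟨q, hpq.2⟩), Subtype.ext ?_, fun bc hbc => ?_⟩
    · rw [Subring.coe_add, Subring.coe_mul, hιO, hιO, hϖO']; exact ha
    · have hbc' : (a : w.1.adicCompletion E) = toPlace v w bc.1 + toPlace v w bc.2 * ϖE := by
        have := congrArg (fun x : 𝒪[w.1.adicCompletion E] => (x : w.1.adicCompletion E)) hbc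
        simp only [Subring.coe_add, Subring.coe_mul, hιO, hϖO'] at this
        exact this
      have h := huniq (((bc.1 : v.adicCompletion F)), (bc.2 : v.adicCompletion F)) hbc'
      rw [Prod.mk.injEq] at h
      exact Prod.ext (Subtype.ext h.1) (Subtype.ext h.2)
  have hσϖO : σO ϖO = -ϖO := Subtype.ext (by rw [hσO, Subring.coe_neg, hϖO']; exact hσϖE)
  have h2F : ∀ b : 𝒪[v.adicCompletion F], b * 2 = 0 → b = 0 := fun b hb => by
    rcases mul_eq_zero.1 hb with h | h
    · exact h
    · exact absurd h two_ne_zero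
  have h2' : e₂O * 2 = 1 := Subtype.ext (by push_cast; rw [he₂O']; exact h2e)
  have hD' : 4 * DO = tO * tO - yO * yO * ιO ε₀F := Subtype.ext (by push_cast; rw [hιO, hDO', htO', hyO', hε₀F']; exact hD)
  have hu1' : uO - 1 ∈ IsLocalRing.maximalIdeal 𝒪[w.1.adicCompletion E] := hmaxE _ (by push_cast; rw [huO']; exact hu1)
  have ht2' : tO - 2 ∈ IsLocalRing.maximalIdeal 𝒪[w.1.adicCompletion E] := hmaxE _ (by push_cast; rw [htO']; exact ht2)
  have hx1 : ((uO, lamO) : 𝒪[w.1.adicCompletion E] × 𝒪[w₁.1.adicCompletion M]) * RingHom.prodMap σO σ₁O (uO, lamO) = 1 := by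
    refine Prod.ext (Subtype.ext ?_) (Subtype.ext ?_)
    · change ((uO * σO uO : 𝒪[w.1.adicCompletion E]) : w.1.adicCompletion E) = 1
      rw [Subring.coe_mul, hσO, huO']; exact hσu
    · change ((lamO * σ₁O lamO : 𝒪[w₁.1.adicCompletion M]) : w₁.1.adicCompletion M) = 1
      rw [Subring.coe_mul, hσ₁O, hlamO]; exact hlam1
  have huv : Valued.v u = 1 := hsq _ (by have h := congrArg Valued.v hσu; rwa [map_mul, hσv, map_one] at h)
  have huD : IsUnit (uO * DO) := by rw [hunitE, Subring.coe_mul, map_mul, huO', hDO', huv, hDv, one_mul]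
  -- uniformisers and valuations
  have hϖu : IsUniformizingElement ϖE := isUniformizingElement_of_v_eq hϖEv
  have hϖOu : IsUniformizingElement ((ϖO : 𝒪[w.1.adicCompletion E]) : w.1.adicCompletion E) := by rw [hϖO']; exact hϖu
  have hϖF : IsUniformizingElement k₀ := isUniformizingElement_of_v_eq hk₀
  have hk₀Fv : valuation (v.adicCompletion F) ((k₀F : 𝒪[v.adicCompletion F]) : v.adicCompletion F) = valuation (v.adicCompletion F) k₀ := by rw [hk₀F']
  have hϖOsq : ϖO * ϖO = ιO k₀F := Subtype.ext (by rw [Subring.coe_mul, hιO, hϖO', hk₀F', ← sq]; exact hϖE)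
  have hϖOv : valuation (w.1.adicCompletion E) ((ϖO : 𝒪[w.1.adicCompletion E]) : w.1.adicCompletion E) = valuation (w.1.adicCompletion E) ϖE := by rw [hϖO']
  have hpow : ∀ m : ℕ, Valued.v (ϖE ^ m) = WithZero.exp (-(m : ℤ)) := fun m => by
    rw [map_pow, hϖEv, ← WithZero.exp_nsmul]; congr 1; simp
  have hn' : valuation (w.1.adicCompletion E) ((uO * uO - tO * uO + DO : 𝒪[w.1.adicCompletion E]) : w.1.adicCompletion E) =
      valuation (w.1.adicCompletion E) ϖE ^ n := by
    rw [← map_pow, ← v_eq_iff_valuation_eq, hpow]; push_cast; rw [huO', htO', hDO']; exact hn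
  have hN' : valuation (w.1.adicCompletion E) ((yO : 𝒪[w.1.adicCompletion E]) : w.1.adicCompletion E) = valuation (w.1.adicCompletion E) ϖE ^ N := by
    rw [← map_pow, ← v_eq_iff_valuation_eq, hpow, hyO']; exact hN
  -- `#𝓀_v = N(v)`
  have hqv : Nat.card 𝓀[v.adicCompletion F] = Ideal.absNorm v.asIdeal := natCard_residueField_eq_absNorm v
  -- ### 4. assembly
  refine ⟨ιO, σO, jO, σ₁O, uO, tO, yO, DO, e₂O, lamO, hιO, hσO, hjO, hσ₁O, huO', htO', hyO', hDO', he₂O', hlamO, ?_, ?_⟩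
  · intro hs'θ hm
    have hσ₁θ : σ₁O θO = θO := Subtype.ext (by rw [hσ₁O, hθO']; exact hs'θ)
    have hnsF : ∀ b : 𝒪[v.adicCompletion F], IsUnit (b * b - ε₀F) := fun b => by
      have h := hns (toPlace v w b) (by rw [hιv]; exact pow_le_one₀ zero_le ((v_le_one_iff_mem_integer _).2 b.2))
      rw [← map_mul, ← map_sub, hιv] at h
      rw [hunitF]; push_cast; rw [hε₀F']
      exact (pow_left_inj₀ zero_le zero_le two_ne_zero).1 (by rw [h, one_pow])
    rw [← hqv]
    exact relIndex_units_comap_norm_eq_typeA ιO σO jO σ₁O θO uO hθ' hnsO hcoordO h2' hD' hlamOdef hu1' ht2' hϖu hn' hN' hσσ hσ₁σ₁ hσ₁j hx1 huD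
      hcoordEO hσι hσϖO h2F hϖOu hϖOsq hϖF hk₀Fv hϖOv rfl hN1 hNn hσ₁θ hm hnsF
  · intro hs'θ hm
    have hσ₁θ : σ₁O θO = -θO := Subtype.ext (by rw [hσ₁O, Subring.coe_neg, hθO']; exact hs'θ)
    rw [← hqv]
    exact relIndex_units_comap_norm_eq_typeB ιO σO jO σ₁O θO uO hθ' hnsO hcoordO h2' hD' hlamOdef hu1' ht2' hϖu hn' hN' hσσ hσ₁σ₁ hσ₁j hx1 huD
      hcoordEO hσι hσϖO h2F hϖOu hϖOsq hϖF hk₀Fv hϖOv rfl hN1 hNn hσ₁θ hm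

end Literature.NumberTheory.Rogawski1990

end
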